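import Summits.ResolutionOfSingularities.ResolutionOfSingularities.Theorems.PerronInitialChart
import HarnessLib

/-!
# PerronRepresentations — decomp-res node «PerronLadder» (lens-1 g17 KaplanskyLadder → g18 PerronLadder), tree
file 9/11 of the node

Content VERBATIM from the decomp-res lens-1 g18 file `HOME/decomp-res-lens-1/g18/PerronLadder.lean` (sha256
8bb02ceefe11b749, 3725 l; it SUPERSEDES
g17 `KaplanskyLadder.lean` fb35e2e5 ⊇ g16 `ToricLadder.lean` 67376591 as landing source; PARTS I–III = the
landed `Theorems/ToricLadderCells`,
`ToricLadderKernels`, `ToricLadderLinks`, `ToricLadderDense`, `ToricLadder` — not repeated).  HOME =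
run/shared/lean/pub/decomp-res.  Critic:
CRITIC-LEDGER rows 131 (g17, 2026-08-30T18:47:14Z) and 138 (g18 CLEARED, landing order 2026-08-30T20:05:14Z); the
lens's WRITER.md (endorsed).
Landed by decomp-res writer g7 as SUPPORT of the Valuative route item 0641 `LuAlphaPTorsor` (helper files; no
Valuative route edit is made by the
decomp-res cell: the support ports Σ₁ `MonoidalStep` / Π₁ `KK05NCVAscent`, the retirement of g16's all-rank
`ToricAscent 3` in favour of the theorem
`toricAscentRk1_three`, and the UNCHANGED located residual `NonKHToricArchLU 3 3 4` / port-free `NonKHArchLU 3 4`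
stay documented tree definitions
for the Valuative tenure / operator to book).

PART V-F (g18 NEW) §22 KERNEL: representations of the elements of `F₁(x)` over the base (`exists_rep_of_mem_toricField`,
`exists_rep_integral`).  PROVED, 0 sorry.

[WRITER NOTE (decomp-res writer g7): namespaces `…Theses.PerronLadder` ↦ `…Theorems.KaplanskyLadder` (PART IV
= g17 §14–§16, files
`KaplanskyLadder`, `KaplanskyLadderDefectless`) and ↦ `…Theorems.PerronLadder` (PART V, files `PerronMerge`
§17, `PerronCharts` §18–§19,
`PerronMonomialization` §20, `PerronInitialChartPrelim` + `PerronInitialChart` §21 (400-line limit),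
`PerronRepresentations` §22, `PerronAscent`
§23, `PerronLadder` §24; PART IV likewise `KaplanskyHensel` §14 / `KaplanskyLadder` §15), with `open
…Theorems.ToricLadder` (+ `…KaplanskyLadder`) so the lens's unqualified references stay verbatim; `section PartV` and its
section-scoped `open`s re-opened per file; the g16 helper `intermediateField_top_fg` is the landed
`PfaffLine.intermediateField_top_fg_of_isFractionRing`
(renamed at its use, as in the landed `ToricLadder`); global `set_option` lines dropped; nothing else changed.]

(Sources: CossartPiltant2019; CossartJannsenSaito2020; KnafKuhlmann2005 arXiv:math/0304159 §4 Thm 4.1, Lemmas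
4.2–4.4; KnafKuhlmann2009 arXiv:math/0702856 Prop 3.11, Thm 1.5; Kaplansky1942 Lemma 5, Thm 3; Kuhlmann2010 Thm
2.14; Zariski1940 §B; Cutkosky arXiv:1404.7459 §2.1; ZariskiSamuelII.)
-/

noncomputable section

open IsLocalRing Literature.AlgebraicGeometry.Resolution
open Summit.ResolutionOfSingularities.ResolutionOfSingularities.Theses
open Summit.ResolutionOfSingularities.ResolutionOfSingularities.Theorems
open Summit.ResolutionOfSingularities.ResolutionOfSingularities.Theorems.PfaffLine
open Summit.ResolutionOfSingularities.ResolutionOfSingularities.Theorems.ToricLadder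

namespace Summit.ResolutionOfSingularities.ResolutionOfSingularities.Theorems.PerronLadder

section PartV

open Finset
open CategoryTheory CategoryTheory.Limits AlgebraicGeometry TopologicalSpace
open Scheme.IdealSheafData
open scoped Classical

/-! ## 22. PART V-F · KERNEL: representations of the elements of `F₁(x)` over the base -/

section Representations

variable {k : Type} [Field k] {K : Type} [Field K] [Algebra k K]

/-- **K1 · representations.**  Every element of `F₁(x)` is a quotient of two polynomials in `x` with
coefficients in `F₁` (`F₁ ⊔ k(x) = F₁(x)` and `IntermediateField.mem_adjoin_iff`). [folklore] -/
theorem exists_rep_of_mem_toricField (F₁ : IntermediateField k K) {ρ : ℕ} (x : Fin ρ → K) {z : K}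
    (hz : z ∈ (toricField F₁ x).toSubfield) :
    ∃ P Q : MvPolynomial (Fin ρ) K, (∀ e, P.coeff e ∈ F₁) ∧ (∀ e, Q.coeff e ∈ F₁) ∧
      MvPolynomial.eval x Q ≠ 0 ∧ z * MvPolynomial.eval x Q = MvPolynomial.eval x P := by
  classical
  have hz' : z ∈ IntermediateField.adjoin F₁ (Set.range x) := by
    have h1 : z ∈ toricField F₁ x := (IntermediateField.mem_toSubfield _ _).mp hz
    have h2 : IntermediateField.restrictScalars k (IntermediateField.adjoin F₁ (Set.range x)) =
        toricField F₁ x :=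
      IntermediateField.restrictScalars_adjoin_eq_sup k F₁ (Set.range x)
    rw [← h2, IntermediateField.mem_restrictScalars] at h1
    exact h1
  rw [IntermediateField.mem_adjoin_iff] at hz'
  obtain ⟨r, s, hrs⟩ := hz'
  let ι : Set.range x → Fin ρ := fun y => y.2.choose
  have hι : ∀ y : Set.range x, x (ι y) = y := fun y => y.2.choose_spec
  have hxι : x ∘ ι = Subtype.val := funext hι
  let lift : MvPolynomial (Set.range x) F₁ → MvPolynomial (Fin ρ) K := fun p =>
    MvPolynomial.map (algebraMap F₁ K) (MvPolynomial.rename ι p)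
  have hlift_eval : ∀ p, MvPolynomial.eval x (lift p) =
      MvPolynomial.aeval (Subtype.val : Set.range x → K) p := by
    intro p
    change MvPolynomial.eval x (MvPolynomial.map (algebraMap F₁ K) (MvPolynomial.rename ι p)) = _
    rw [MvPolynomial.eval_map, ← MvPolynomial.aeval_def, MvPolynomial.aeval_rename, hxι]
  have hlift_coeff : ∀ p e, (lift p).coeff e ∈ F₁ := fun p e => by
    change (MvPolynomial.map (algebraMap F₁ K) (MvPolynomial.rename ι p)).coeff e ∈ F₁
    rw [MvPolynomial.coeff_map]
    exact ((MvPolynomial.rename ι p).coeff e).2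
  by_cases hs : MvPolynomial.aeval (Subtype.val : Set.range x → K) s = 0
  · refine ⟨0, 1, fun e => by simp, fun e => ?_, by simp, ?_⟩
    · rw [MvPolynomial.coeff_one]
      split_ifs
      · exact F₁.one_mem
      · exact F₁.zero_mem
    · rw [hrs, hs, div_zero]
      simp
  · refine ⟨lift r, lift s, hlift_coeff r, hlift_coeff s, by rwa [hlift_eval], ?_⟩
    rw [hlift_eval, hlift_eval, hrs, div_mul_cancel₀ _ hs]

/-- **K1' · integral representations.**  Clearing denominators: the coefficients may be taken in an
affine model `B₀` with `Frac B₀ = F₁`. [folklore] -/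
theorem exists_rep_integral (F₁ : IntermediateField k K) (B₀ : Subalgebra k K)
    (hfrac : ∀ y : K, y ∈ F₁ → ∃ a ∈ B₀, ∃ b ∈ B₀, b ≠ 0 ∧ y = a / b)
    {ρ : ℕ} (x : Fin ρ → K) {z : K} (hz : z ∈ (toricField F₁ x).toSubfield) :
    ∃ P Q : MvPolynomial (Fin ρ) K, (∀ e, P.coeff e ∈ B₀) ∧ (∀ e, Q.coeff e ∈ B₀) ∧
      MvPolynomial.eval x Q ≠ 0 ∧ z * MvPolynomial.eval x Q = MvPolynomial.eval x P := by
  classical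
  obtain ⟨P, Q, hP, hQ, hQ0, hzPQ⟩ := exists_rep_of_mem_toricField F₁ x hz
  choose fa hfa fb hfb hfb0 hfeq using hfrac
  -- a common denominator
  let D : K := (∏ e ∈ P.support, fb (P.coeff e) (hP e)) * ∏ e ∈ Q.support, fb (Q.coeff e) (hQ e)
  have hDB : D ∈ B₀ :=
    mul_mem (prod_mem fun e _ => hfb _ _) (prod_mem fun e _ => hfb _ _)
  have hD0 : D ≠ 0 :=
    mul_ne_zero (Finset.prod_ne_zero_iff.mpr fun e _ => hfb0 _ _)
      (Finset.prod_ne_zero_iff.mpr fun e _ => hfb0 _ _)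
  have hclear : ∀ (c : K) (hc : c ∈ F₁) (D' : K), D' ∈ B₀ → fb c hc * D' * c ∈ B₀ := by
    intro c hc D' hD'
    have h1 : c * fb c hc = fa c hc := (eq_div_iff (hfb0 c hc)).mp (hfeq c hc)
    have h2 : fb c hc * D' * c = D' * fa c hc := by rw [← h1]; ring
    rw [h2]
    exact mul_mem hD' (hfa c hc)
  have hDP : ∀ e, D * P.coeff e ∈ B₀ := by
    intro e
    by_cases he : e ∈ P.support
    · have : D = fb (P.coeff e) (hP e) *
          ((∏ e' ∈ P.support.erase e, fb (P.coeff e') (hP e')) *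
            ∏ e' ∈ Q.support, fb (Q.coeff e') (hQ e')) := by
        change (∏ e ∈ P.support, fb (P.coeff e) (hP e)) * _ = _
        rw [← Finset.mul_prod_erase P.support (fun e' => fb (P.coeff e') (hP e')) he, mul_assoc]
      rw [this]
      exact hclear _ _ _ (mul_mem (prod_mem fun _ _ => hfb _ _) (prod_mem fun _ _ => hfb _ _))
    · rw [MvPolynomial.notMem_support_iff.mp he, mul_zero]
      exact B₀.zero_mem
  have hDQ : ∀ e, D * Q.coeff e ∈ B₀ := by
    intro e
    by_cases he : e ∈ Q.support
    · have : D = fb (Q.coeff e) (hQ e) *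
          ((∏ e' ∈ P.support, fb (P.coeff e') (hP e')) *
            ∏ e' ∈ Q.support.erase e, fb (Q.coeff e') (hQ e')) := by
        change _ * (∏ e ∈ Q.support, fb (Q.coeff e) (hQ e)) = _
        rw [← Finset.mul_prod_erase Q.support (fun e' => fb (Q.coeff e') (hQ e')) he]
        ring
      rw [this]
      exact hclear _ _ _ (mul_mem (prod_mem fun _ _ => hfb _ _) (prod_mem fun _ _ => hfb _ _))
    · rw [MvPolynomial.notMem_support_iff.mp he, mul_zero]
      exact B₀.zero_mem
  refine ⟨MvPolynomial.C D * P, MvPolynomial.C D * Q, fun e => ?_, fun e => ?_, ?_, ?_⟩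
  · rw [MvPolynomial.coeff_C_mul]; exact hDP e
  · rw [MvPolynomial.coeff_C_mul]; exact hDQ e
  · rw [map_mul (MvPolynomial.eval x) (MvPolynomial.C D) Q, MvPolynomial.eval_C]
    exact mul_ne_zero hD0 hQ0
  · rw [map_mul (MvPolynomial.eval x) (MvPolynomial.C D) Q,
      map_mul (MvPolynomial.eval x) (MvPolynomial.C D) P, MvPolynomial.eval_C, mul_left_comm, hzPQ]

end Representations

end PartV

end Summit.ResolutionOfSingularities.ResolutionOfSingularities.Theorems.PerronLadder
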